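import Summits.HubbardSuperconductivity.HubbardSuperconductivity.Theorems.SsbToEvenTorusLro.Negative.SzLabelAndOddSector
import Literature.MathematicalPhysics.QuantumLattice.HubbardRingPerronFrobeniusProofs
import Literature.MathematicalPhysics.QuantumLattice.SectorSpectrum
import Literature.MathematicalPhysics.QuantumLattice.ApproximateEigenvectorLemmas
import Literature.MathematicalPhysics.QuantumLattice.DWaveSourceProofs
import HarnessLib

/-!
# Route `AposterioriCapRg` — crux `SsbToEvenTorusLro` (stmt-HubbardSuperconductivity-1315),
# line `floating-mu-two-sided-pair-transfer`, stub `stub_lowManifoldTransfer` (the TRANSFER)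

The pure linear-algebra half of the sector-hopping ladder. Fix a real `U`, a torus side `L`, a
particle number `n` and write `H = hubbardTorus 2 L 1 U`, `S = szSector n 0` (a coordinate
subspace of the Fock space which `H` leaves invariant), `E_n = H.minEnergyOn S`,
`P = pairField dWaveFormFactor L`, `Q = PᴴP ≥ 0`, and, for a window `τ > 0`, the LOW MANIFOLD
`V = span {φ ∈ S | Hφ = Eφ, E ≤ E_n + τ}` (the spectral subspace of `H|_S` below `E_n + τ`).
RIGIDITY (a hypothesis here; the physics input of the line) says `‖(Q - λL⁴)x‖ ≤ ρL⁴‖x‖` on `V`.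

* `lmt_sector_markov_split` — the **Markov (Chebyshev) split** of a vector `φ` of an invariant
  coordinate sector `K` of a Hermitian matrix `A` along the eigenbasis of the compression `A|_K`:
  `φ = v + w` with `v` in the span of the eigenvectors of `A` in `K` of energy `≤ E₀ + τ`
  (`E₀ = minEnergyOn A K`), `v ⊥ w`, and `E₀‖v‖² + (E₀ + τ)‖w‖² ≤ Re⟨φ, Aφ⟩`. Proof: the compression
  `B = A.submatrix` to `Subtype p` is Hermitian; Mathlib's `Matrix.IsHermitian.eigenvectorUnitary`
  diagonalises it (`conjStarAlgAut_star_eigenvectorUnitary`); split the coefficient vector `Uᴴφ` at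
  the threshold and transport along extension by zero exactly as in `sector_groundState`
  (`Literature/MathematicalPhysics/QuantumLattice/SectorSpectrum.lean`), whose variational bound
  gives `E₀ ≤` every eigenvalue of `B`.
* `stub_lowManifoldTransfer` — the **TRANSFER**: if one unit vector `φ ∈ S` is bright
  (`Re⟨φ, Qφ⟩ ≥ B`) and has excess energy `Re⟨φ, Hφ⟩ ≤ E_n + θ` with `2θ ≤ τ`, then EVERY unit
  vector `u ∈ V` is bright: `Re⟨u, Qu⟩ ≥ B - 4ρL⁴ - K(θ/τ)L⁴` with `K = c_d²`,
  `c_d = 2 Σ_{e ∈ {0, ±e₁, ±e₂}} |d(e)/√2|` the constant of `norm_pairField_le` (`‖P‖ ≤ c_d L²`).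
  Proof: Markov split `φ = v + w`, so `‖w‖² ≤ θ/τ ≤ 1/2 ≤ ‖v‖²`; with `r = Qv - λL⁴v`,
  `‖r‖ ≤ ρL⁴‖v‖` (rigidity, `v ∈ V`) and `Q = Qᴴ`, `v ⊥ w`:
  `B ≤ Re⟨φ,Qφ⟩ = Re⟨v,Qv⟩ + 2Re⟨r,w⟩ + Re⟨w,Qw⟩ ≤ Re⟨v,Qv⟩ + ρL⁴ + c_d²L⁴(θ/τ)`;
  `Re⟨v,Qv⟩ ≤ (λ + ρ)L⁴‖v‖² ≤ (λ + ρ)L⁴` (Cauchy–Schwarz; `Q ≥ 0` forces `λ + ρ ≥ 0`) and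
  `Re⟨u,Qu⟩ ≥ (λ - ρ)L⁴` for the unit vector `u ∈ V` (`norm_expect_sub_le`).

Everything is finite-dimensional linear algebra over landed tree lemmas and Mathlib's spectral
theorem; no definition and no named fact is introduced. The parity guard (`szSector n 0 = ⊥` for odd
`n`, `eq_zero_of_mem_szSector_zero_odd`) disposes of odd `n`; for `n = 2k` the sector is Lieb's
`(k, k)` coordinate sector (`mem_szSector_two_mul_zero_iff`, `preservesSectors_hamiltonian`).

Sources: H. Tasaki, *Physics and Mathematics of Quantum Many-Body Systems* (2020) §2.2, §A.2
(variational principle, spectral decomposition in a symmetry sector); E. H. Lieb, PRL 62 (1989) 1201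
("work in the `S^z = 0` subspace"); T. Koma, H. Tasaki, J. Stat. Phys. 76 (1994) 745 (low-energy
states and order). All statements are folklore.
-/

noncomputable section

namespace Summit.HubbardSuperconductivity.HubbardSuperconductivity.Theorems

-- summit = problem name (single-conjunct summit), D-0017
set_option linter.dupNamespace false

open Literature.MathematicalPhysics.QuantumLattice Literature.Probability.LatticeModels
open Filter Set Matrix
open scoped ComplexOrder ComplexConjugate Matrix.Norms.L2Operator

/-- **Markov (Chebyshev) split along an invariant coordinate sector.** Let `A` be Hermitian,
`K = {v | v i = 0 unless p i}` a coordinate subspace with no matrix entries of `A` from `p` to `¬p`,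
`E₀ = A.minEnergyOn K` and `τ : ℝ`. Every `φ ∈ K` splits as `φ = v + w` with `v` in the span of the
eigenvectors of `A` lying in `K` with eigenvalue `≤ E₀ + τ`, `⟨v, w⟩ = 0`, and
`E₀ ‖v‖² + (E₀ + τ) ‖w‖² ≤ Re ⟨φ, A φ⟩` (so `τ‖w‖²` is at most the excess energy of `φ`).
Spectral theorem for the Hermitian compression `A.submatrix Subtype.val Subtype.val`, transported
along extension by zero (`sector_groundState`). Tasaki (2020) §2.2, §A.2. [folklore] -/
theorem lmt_sector_markov_split {ι : Type*} [Fintype ι] [DecidableEq ι]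
    (A : Matrix ι ι ℂ) (hA : A.IsHermitian) (p : ι → Prop) [DecidablePred p]
    (hinv : ∀ i j, ¬ p i → p j → A i j = 0)
    (K : Submodule ℂ (ι → ℂ)) (hK : ∀ v, v ∈ K ↔ ∀ i, ¬ p i → v i = 0) (τ : ℝ)
    (φ : ι → ℂ) (hφ : φ ∈ K) :
    ∃ v ∈ Submodule.span ℂ
        {ψ : ι → ℂ | ψ ∈ K ∧ ∃ E : ℝ, A *ᵥ ψ = (E : ℂ) • ψ ∧ E ≤ A.minEnergyOn K + τ},
      ∃ w : ι → ℂ, φ = v + w ∧ star v ⬝ᵥ w = 0 ∧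
        A.minEnergyOn K * (star v ⬝ᵥ v).re + (A.minEnergyOn K + τ) * (star w ⬝ᵥ w).re ≤
          (star φ ⬝ᵥ A *ᵥ φ).re := by
  classical
  -- the compression `B` of `A` to the sector; extension by zero `ext`, restriction `res`
  set B : Matrix (Subtype p) (Subtype p) ℂ := A.submatrix Subtype.val Subtype.val
  have hBh : B.IsHermitian := hA.submatrix _
  set ext : (Subtype p → ℂ) →ₗ[ℂ] (ι → ℂ) := Function.ExtendByZero.linearMap ℂ Subtype.val
    with hext
  set res : (ι → ℂ) → (Subtype p → ℂ) := fun v a => v a.1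
  have hext_apply : ∀ ψ (a : Subtype p), ext ψ a.1 = ψ a := fun ψ a => by
    rw [hext, Function.ExtendByZero.linearMap_apply]
    exact Subtype.val_injective.extend_apply _ _ a
  have hext_not : ∀ ψ i, ¬ p i → ext ψ i = 0 := fun ψ i hi => by
    rw [hext, Function.ExtendByZero.linearMap_apply,
      Function.extend_apply' _ _ _ fun ⟨a, ha⟩ => hi (ha ▸ a.2)]
    rfl
  have hres_ext : ∀ ψ, res (ext ψ) = ψ := fun ψ => funext fun a => hext_apply ψ a
  have hext_res : ∀ v ∈ K, ext (res v) = v := fun v hv => by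
    funext i
    by_cases hi : p i
    · exact hext_apply (res v) ⟨i, hi⟩
    · rw [hext_not _ i hi, ((hK v).1 hv) i hi]
  have hext_mem : ∀ ψ, ext ψ ∈ K := fun ψ => (hK _).2 fun i hi => hext_not ψ i hi
  have hAext : ∀ ψ, A *ᵥ ext ψ = ext (B *ᵥ ψ) := by
    intro ψ; funext i
    rw [mulVec, dotProduct]
    by_cases hi : p i
    · have h1 : ext (B *ᵥ ψ) i = (B *ᵥ ψ) ⟨i, hi⟩ := hext_apply (B *ᵥ ψ) ⟨i, hi⟩
      rw [h1, mulVec, dotProduct, sum_eq_sum_subtype_of_support p]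
      · refine Finset.sum_congr rfl fun a _ => ?_
        rw [hext_apply]; rfl
      · intro j hj; rw [hext_not ψ j hj, mul_zero]
    · rw [hext_not _ i hi]
      refine Finset.sum_eq_zero fun j _ => ?_
      by_cases hj : p j
      · rw [hinv i j hi hj, zero_mul]
      · rw [hext_not ψ j hj, mul_zero]
  have hdot : ∀ ψ (x : ι → ℂ), star (ext ψ) ⬝ᵥ x = star ψ ⬝ᵥ res x := by
    intro ψ x
    rw [dotProduct, dotProduct, sum_eq_sum_subtype_of_support p]
    · refine Finset.sum_congr rfl fun a _ => ?_
      rw [Pi.star_apply, Pi.star_apply, hext_apply]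
    · intro j hj; rw [Pi.star_apply, hext_not ψ j hj, star_zero, zero_mul]
  -- orthonormal eigenbasis of the compression (columns of the unitary `U`)
  set U : Matrix (Subtype p) (Subtype p) ℂ :=
    (hBh.eigenvectorUnitary : Matrix (Subtype p) (Subtype p) ℂ)
  set ev : Subtype p → ℝ := hBh.eigenvalues with hev
  have hUU : Uᴴ * U = 1 := Unitary.coe_star_mul_self hBh.eigenvectorUnitary
  have hUU' : U * Uᴴ = 1 := Unitary.coe_mul_star_self hBh.eigenvectorUnitary
  have hD : Uᴴ * B * U = diagonal (fun j => ((ev j : ℝ) : ℂ)) := by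
    have h := hBh.conjStarAlgAut_star_eigenvectorUnitary
    rw [Unitary.conjStarAlgAut_star_apply] at h
    exact h
  have hiso : ∀ x y : Subtype p → ℂ, star (U *ᵥ x) ⬝ᵥ (U *ᵥ y) = star x ⬝ᵥ y := fun x y => by
    rw [star_mulVec, ← dotProduct_mulVec, mulVec_mulVec, hUU, one_mulVec]
  set E₀ := A.minEnergyOn K
  have hE₀ev : ∀ j, E₀ ≤ ev j := by
    intro j
    have h1 : star (ext (U *ᵥ Pi.single j 1)) ⬝ᵥ ext (U *ᵥ Pi.single j 1) = 1 := by
      rw [hdot, hres_ext, hiso]; simp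
    have h2 := (sector_groundState A hA p ⟨j.1, j.2⟩ hinv K hK).2 _ (hext_mem _) h1
    rw [hAext, hdot, hres_ext, hBh.eigenvectorUnitary_mulVec] at h2
    rw [hev, hBh.eigenvalues_eq j]
    simpa using h2
  -- coefficients of `φ` in the eigenbasis, split at `E₀ + τ`
  set c : Subtype p → ℂ := Uᴴ *ᵥ res φ with hc
  have hφU : φ = ext (U *ᵥ c) := by rw [hc, mulVec_mulVec, hUU', one_mulVec, hext_res φ hφ]
  set cq : Subtype p → ℂ := fun j => if ev j ≤ E₀ + τ then c j else 0 with hcq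
  set cq' : Subtype p → ℂ := fun j => if ev j ≤ E₀ + τ then 0 else c j with hcq'
  have hcc : cq + cq' = c := by
    funext j; by_cases hj : ev j ≤ E₀ + τ <;> simp [hcq, hcq', hj]
  refine ⟨ext (U *ᵥ cq), ?_, ext (U *ᵥ cq'), ?_, ?_, ?_⟩
  · -- the low part lies in the span of the low eigenvectors
    have hsum : U *ᵥ cq = ∑ j, cq j • (U *ᵥ Pi.single j 1) := by
      conv_lhs => rw [← Finset.univ_sum_single cq]
      rw [mulVec_sum]
      refine Finset.sum_congr rfl fun j _ => ?_
      rw [← mulVec_smul, ← Pi.single_smul', smul_eq_mul, mul_one]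
    rw [hsum, map_sum]
    refine Submodule.sum_mem _ fun j _ => ?_
    rw [map_smul]
    by_cases hj : ev j ≤ E₀ + τ
    · refine Submodule.smul_mem _ _ (Submodule.subset_span ⟨hext_mem _, ev j, ?_, hj⟩)
      rw [hAext, hBh.eigenvectorUnitary_mulVec, hBh.mulVec_eigenvectorBasis, ← Complex.coe_smul,
        map_smul]
    · have : cq j = 0 := by simp [hcq, hj]
      rw [this, zero_smul]
      exact Submodule.zero_mem _
  · rw [← map_add, ← mulVec_add, hcc, hφU]
  · rw [hdot, hres_ext, hiso, dotProduct]
    refine Finset.sum_eq_zero fun j _ => ?_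
    by_cases hj : ev j ≤ E₀ + τ <;> simp [hcq, hcq', hj]
  · have hR : star φ ⬝ᵥ A *ᵥ φ = star c ⬝ᵥ (diagonal (fun j => ((ev j : ℝ) : ℂ)) *ᵥ c) := by
      rw [hφU, hAext, hdot, hres_ext, star_mulVec, ← dotProduct_mulVec, mulVec_mulVec,
        mulVec_mulVec, hD]
    have hv2 : star (ext (U *ᵥ cq)) ⬝ᵥ ext (U *ᵥ cq) = star cq ⬝ᵥ cq := by
      rw [hdot, hres_ext, hiso]
    have hw2 : star (ext (U *ᵥ cq')) ⬝ᵥ ext (U *ᵥ cq') = star cq' ⬝ᵥ cq' := by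
      rw [hdot, hres_ext, hiso]
    rw [hv2, hw2, hR]
    have hzz : ∀ z : ℂ, (star z * z).re = ‖z‖ ^ 2 := fun z => by
      rw [Complex.star_def, Complex.conj_mul', ← Complex.ofReal_pow, Complex.ofReal_re]
    have hzrz : ∀ (z : ℂ) (r : ℝ), (star z * ((r : ℂ) * z)).re = r * ‖z‖ ^ 2 := fun z r => by
      rw [mul_left_comm, Complex.re_ofReal_mul, hzz]
    simp only [dotProduct, mulVec_diagonal, Pi.star_apply, Complex.re_sum, Finset.mul_sum,
      ← Finset.sum_add_distrib]
    refine Finset.sum_le_sum fun j _ => ?_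
    by_cases hj : ev j ≤ E₀ + τ
    · simp only [hcq, hcq', hj, if_true, star_zero, mul_zero, Complex.zero_re, add_zero, hzz, hzrz]
      exact mul_le_mul_of_nonneg_right (hE₀ev j) (sq_nonneg _)
    · simp only [hcq, hcq', hj, if_false, star_zero, mul_zero, Complex.zero_re, zero_add, hzz, hzrz]
      exact mul_le_mul_of_nonneg_right (le_of_lt (not_le.1 hj)) (sq_nonneg _)

/-- **Low-manifold transfer** (stub `stub_lowManifoldTransfer` of line
`floating-mu-two-sided-pair-transfer`). There is `K ≥ 0` (namely `K = c_d²`, where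
`‖pairField d L‖ ≤ c_d L²`) such that for all `U, L, n, τ > 0, ρ ≥ 0, θ ≥ 0` with `2θ ≤ τ`: if
`PᴴP` (`P = pairField dWaveFormFactor L`) is `ρL⁴`-rigid with scalar `λL⁴` on the low manifold
`V = span {φ ∈ szSector n 0 | Hφ = Eφ, E ≤ E_n + τ}` of `H = hubbardTorus 2 L 1 U`, and some
unit `φ ∈ szSector n 0` has `Re⟨φ, Hφ⟩ ≤ E_n + θ` and
`B ≤ Re⟨φ, PᴴPφ⟩`, then every unit `u ∈ V` has `B - 4ρL⁴ - K(θ/τ)L⁴ ≤ Re⟨u, PᴴPu⟩`.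
(Markov split `lmt_sector_markov_split` + Cauchy–Schwarz; see the module docstring.) [folklore] -/
theorem stub_lowManifoldTransfer :
    ∃ K : ℝ, 0 ≤ K ∧ ∀ (U : ℝ) (L : ℕ) [NeZero L] (n : ℕ) (τ ρ θ B lam : ℝ), 0 < τ → 0 ≤ ρ → 0 ≤ θ → 2 * θ ≤ τ → (∀ v ∈ Submodule.span ℂ {φ : Fock (Orb (FermionTorus 2 L)) | φ ∈ szSector n 0 ∧ ∃ E : ℝ, hubbardTorus 2 L 1 U *ᵥ φ = (E : ℂ) • φ ∧ E ≤ (hubbardTorus 2 L 1 U).minEnergyOn (szSector n 0) + τ}, (star (((pairField dWaveFormFactor L)ᴴ * pairField dWaveFormFactor L) *ᵥ v - ((lam * (L : ℝ) ^ 4 : ℝ) : ℂ) • v) ⬝ᵥ (((pairField dWaveFormFactor L)ᴴ * pairField dWaveFormFactor L) *ᵥ v - ((lam * (L : ℝ) ^ 4 : ℝ) : ℂ) • v)).re ≤ ρ ^ 2 * (L : ℝ) ^ 8 * (star v ⬝ᵥ v).re) → ∀ φ : Fock (Orb (FermionTorus 2 L)), φ ∈ szSector n 0 → star φ ⬝ᵥ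 φ = 1 → (expect (hubbardTorus 2 L 1 U) φ).re ≤ (hubbardTorus 2 L 1 U).minEnergyOn (szSector n 0) + θ → B ≤ (expect ((pairField dWaveFormFactor L)ᴴ * pairField dWaveFormFactor L) φ).re → ∀ u ∈ Submodule.span ℂ {φ : Fock (Orb (FermionTorus 2 L)) | φ ∈ szSector n 0 ∧ ∃ E : ℝ, hubbardTorus 2 L 1 U *ᵥ φ = (E : ℂ) • φ ∧ E ≤ (hubbardTorus 2 L 1 U).minEnergyOn (szSector n 0) + τ}, star u ⬝ᵥ u = 1 → B - 4 * ρ * (L : ℝ) ^ 4 - K * (θ / τ) * (L : ℝ) ^ 4 ≤ (expect ((pairField dWaveFormFactor L)ᴴ * pairField dWaveFormFactor L) u).re := by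
  set c₀ : ℝ := 2 * ∑ e ∈ insert (0 : Site 2) unitSteps, |dWaveFormFactor e / Real.sqrt 2|
  refine ⟨c₀ ^ 2, sq_nonneg _, ?_⟩
  intro U L _ n τ ρ θ B lam hτ hρ hθ hθτ hrig φ hφS hφ1 hφE hφB u hu hu1
  -- parity guard: odd sectors are empty
  rcases Nat.even_or_odd n with hn | hn
  swap
  · exfalso
    have h0 := SsbToEvenTorusLro.Negative.eq_zero_of_mem_szSector_zero_odd hn hφS
    rw [h0, star_zero, zero_dotProduct] at hφ1
    exact zero_ne_one hφ1
  obtain ⟨k, rfl⟩ := even_iff_two_dvd.mp hn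
  -- abbreviations
  set H := hubbardTorus 2 L 1 U
  set P := pairField dWaveFormFactor L
  set Q := Pᴴ * P with hQ
  set E₀ := H.minEnergyOn (szSector (2 * k) 0)
  set μ : ℝ := lam * (L : ℝ) ^ 4
  have hL4 : (0 : ℝ) ≤ (L : ℝ) ^ 4 := by positivity
  have hρL : 0 ≤ ρ * (L : ℝ) ^ 4 := mul_nonneg hρ hL4
  -- §1 the Markov split of `φ` along the eigenbasis of `H` compressed to the sector
  have hHh : H.IsHermitian := LiebThm1.hamiltonian_isHermitian (fermionTorusGraph 2 L) 1 U
  have hinv : ∀ s s' : Finset (Orb (FermionTorus 2 L)),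
      ¬((upPart s).card = k ∧ (downPart s).card = k) →
      ((upPart s').card = k ∧ (downPart s').card = k) → H s s' = 0 := by
    intro s s' hs hs'
    by_contra h
    have := LiebThm1.preservesSectors_hamiltonian (fermionTorusGraph 2 L) 1 U s s' h
    exact hs ⟨this.1.trans hs'.1, this.2.trans hs'.2⟩
  have hK : ∀ v : Fock (Orb (FermionTorus 2 L)), v ∈ szSector (2 * k) (0 : ℝ) ↔
      ∀ s, ¬((upPart s).card = k ∧ (downPart s).card = k) → v s = 0 :=
    fun v => mem_szSector_two_mul_zero_iff k v
  obtain ⟨v, hvV, w, hφvw, hvw, hineq⟩ :=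
    lmt_sector_markov_split H hHh _ hinv (szSector (2 * k) 0) hK τ φ hφS
  have hwv : star w ⬝ᵥ v = 0 := by rw [star_dotProduct, hvw, star_zero]
  set nv := (star v ⬝ᵥ v).re
  set nw := (star w ⬝ᵥ w).re
  have hev2 : eucNorm v ^ 2 = nv := eucNorm_sq v
  have hew2 : eucNorm w ^ 2 = nw := eucNorm_sq w
  have hnw0 : 0 ≤ nw := hew2 ▸ sq_nonneg _
  have hn1 : nv + nw = 1 := by
    have h := congrArg Complex.re hφ1
    rw [hφvw, star_add, add_dotProduct, dotProduct_add, dotProduct_add, hvw, hwv] at h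
    simpa using h
  have hE' : (star φ ⬝ᵥ H *ᵥ φ).re ≤ E₀ + θ := hφE
  have hτnw : τ * nw ≤ θ := by
    have h3 : E₀ * (nv + nw) = E₀ * 1 := by rw [hn1]
    linarith only [hineq, hE', h3]
  have hnw_le : nw ≤ θ / τ := by
    rw [le_div_iff₀ hτ]; linarith only [hτnw]
  have hθτ' : θ / τ ≤ 1 / 2 := by
    rw [div_le_iff₀ hτ]; linarith only [hθτ]
  have hnv_pos : 0 < nv := by linarith only [hn1, hnw_le, hθτ']
  have hnv1 : nv ≤ 1 := by linarith only [hn1, hnw0]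
  have hevw : eucNorm v * eucNorm w ≤ 1 / 2 := by
    have h := sq_nonneg (eucNorm v - eucNorm w)
    linarith only [h, hev2, hew2, hn1]
  -- §2 rigidity on the low part `v`: `r = Qv - μv` is small
  set r := Q *ᵥ v - (μ : ℂ) • v with hr
  have hrv : (star r ⬝ᵥ r).re ≤ ρ ^ 2 * (L : ℝ) ^ 8 * nv := hrig v hvV
  have her : eucNorm r ≤ ρ * (L : ℝ) ^ 4 * eucNorm v := by
    have h1 : eucNorm r ^ 2 ≤ (ρ * (L : ℝ) ^ 4 * eucNorm v) ^ 2 := by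
      calc eucNorm r ^ 2 = (star r ⬝ᵥ r).re := eucNorm_sq r
        _ ≤ ρ ^ 2 * (L : ℝ) ^ 8 * nv := hrv
        _ = (ρ * (L : ℝ) ^ 4 * eucNorm v) ^ 2 := by rw [← hev2]; ring
    have h0 : 0 ≤ ρ * (L : ℝ) ^ 4 * eucNorm v := mul_nonneg hρL (eucNorm_nonneg v)
    exact (pow_le_pow_iff_left₀ (eucNorm_nonneg r) h0 two_ne_zero).1 h1
  -- §3 `B ≤ Re⟨φ, Qφ⟩ = Re⟨v,Qv⟩ + 2 Re⟨r,w⟩ + Re⟨w,Qw⟩`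
  have hQh : Qᴴ = Q := by rw [hQ, conjTranspose_mul, conjTranspose_conjTranspose]
  have hQv : Q *ᵥ v = r + (μ : ℂ) • v := by rw [hr, sub_add_cancel]
  have hcross1 : star v ⬝ᵥ Q *ᵥ w = star r ⬝ᵥ w := by
    conv_lhs => rw [← hQh, dotProduct_mulVec, ← star_mulVec, hQv]
    rw [star_add, add_dotProduct, star_smul, smul_dotProduct, hvw, smul_zero, add_zero]
  have hcross2 : star w ⬝ᵥ Q *ᵥ v = star w ⬝ᵥ r := by
    rw [hQv, dotProduct_add, dotProduct_smul, hwv, smul_zero, add_zero]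
  have hexp : (star φ ⬝ᵥ Q *ᵥ φ).re = (star v ⬝ᵥ Q *ᵥ v).re + (star r ⬝ᵥ w).re +
      (star w ⬝ᵥ r).re + (star w ⬝ᵥ Q *ᵥ w).re := by
    rw [hφvw, mulVec_add, star_add, add_dotProduct, dotProduct_add, dotProduct_add, hcross1,
      hcross2]
    simp only [Complex.add_re]
    ring
  have hb1 : (star r ⬝ᵥ w).re ≤ eucNorm r * eucNorm w :=
    (Complex.re_le_norm _).trans (norm_star_dotProduct_le r w)
  have hb2 : (star w ⬝ᵥ r).re ≤ eucNorm w * eucNorm r :=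
    (Complex.re_le_norm _).trans (norm_star_dotProduct_le w r)
  have hPn : ‖P‖ ≤ c₀ * (L : ℝ) ^ 2 := norm_pairField_le dWaveFormFactor L
  have hQn : ‖Q‖ ≤ c₀ ^ 2 * (L : ℝ) ^ 4 := by
    rw [hQ, Matrix.l2_opNorm_conjTranspose_mul_self]
    calc ‖P‖ * ‖P‖ ≤ (c₀ * (L : ℝ) ^ 2) * (c₀ * (L : ℝ) ^ 2) :=
          mul_le_mul hPn hPn (norm_nonneg _) (by positivity)
      _ = c₀ ^ 2 * (L : ℝ) ^ 4 := by ring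
  have hb3 : (star w ⬝ᵥ Q *ᵥ w).re ≤ c₀ ^ 2 * (L : ℝ) ^ 4 * nw := by
    calc (star w ⬝ᵥ Q *ᵥ w).re ≤ ‖star w ⬝ᵥ Q *ᵥ w‖ := Complex.re_le_norm _
      _ ≤ eucNorm w * eucNorm (Q *ᵥ w) := norm_star_dotProduct_le _ _
      _ ≤ eucNorm w * (‖Q‖ * eucNorm w) :=
          mul_le_mul_of_nonneg_left (eucNorm_mulVec_le Q w) (eucNorm_nonneg _)
      _ = ‖Q‖ * nw := by rw [← hew2]; ring
      _ ≤ c₀ ^ 2 * (L : ℝ) ^ 4 * nw := mul_le_mul_of_nonneg_right hQn hnw0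
  have hX : B - ρ * (L : ℝ) ^ 4 - c₀ ^ 2 * (θ / τ) * (L : ℝ) ^ 4 ≤ (star v ⬝ᵥ Q *ᵥ v).re := by
    have hB' : B ≤ (star φ ⬝ᵥ Q *ᵥ φ).re := hφB
    have h4 : c₀ ^ 2 * (L : ℝ) ^ 4 * nw ≤ c₀ ^ 2 * (L : ℝ) ^ 4 * (θ / τ) :=
      mul_le_mul_of_nonneg_left hnw_le (mul_nonneg (sq_nonneg c₀) hL4)
    have h5 : eucNorm r * eucNorm w ≤ ρ * (L : ℝ) ^ 4 * eucNorm v * eucNorm w :=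
      mul_le_mul_of_nonneg_right her (eucNorm_nonneg w)
    have h7 : ρ * (L : ℝ) ^ 4 * (eucNorm v * eucNorm w) ≤ ρ * (L : ℝ) ^ 4 * (1 / 2) :=
      mul_le_mul_of_nonneg_left hevw hρL
    linarith only [hB', hexp, hb1, hb2, hb3, h4, h5, h7]
  -- §4 Rayleigh quotients of `Q` on the low manifold are pinned to `μ` within `ρL⁴`
  have hX0 : 0 ≤ (star v ⬝ᵥ Q *ᵥ v).re := by
    have := (Matrix.posSemidef_conjTranspose_mul_self P).re_dotProduct_nonneg v
    simpa using this
  have hXle : (star v ⬝ᵥ Q *ᵥ v).re ≤ (μ + ρ * (L : ℝ) ^ 4) * nv := by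
    have h1 : star v ⬝ᵥ r = star v ⬝ᵥ Q *ᵥ v - (μ : ℂ) * star v ⬝ᵥ v := by
      rw [hr, dotProduct_sub, dotProduct_smul, smul_eq_mul]
    have h2 : (star v ⬝ᵥ r).re = (star v ⬝ᵥ Q *ᵥ v).re - μ * nv := by
      rw [h1, Complex.sub_re, Complex.re_ofReal_mul]
    have h3 : (star v ⬝ᵥ r).re ≤ eucNorm v * eucNorm r :=
      (Complex.re_le_norm _).trans (norm_star_dotProduct_le v r)
    have h4 : eucNorm v * eucNorm r ≤ eucNorm v * (ρ * (L : ℝ) ^ 4 * eucNorm v) :=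
      mul_le_mul_of_nonneg_left her (eucNorm_nonneg v)
    have h5 : ρ * (L : ℝ) ^ 4 * eucNorm v ^ 2 = ρ * (L : ℝ) ^ 4 * nv := by rw [hev2]
    linarith only [h2, h3, h4, h5]
  have hY : μ - ρ * (L : ℝ) ^ 4 ≤ (star u ⬝ᵥ Q *ᵥ u).re := by
    have hru : (star (Q *ᵥ u - (μ : ℂ) • u) ⬝ᵥ (Q *ᵥ u - (μ : ℂ) • u)).re ≤
        ρ ^ 2 * (L : ℝ) ^ 8 * (star u ⬝ᵥ u).re := hrig u hu
    rw [hu1, Complex.one_re, mul_one] at hru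
    have h1 : eucNorm (Q *ᵥ u - (μ : ℂ) • u) ≤ ρ * (L : ℝ) ^ 4 := by
      have h2 : eucNorm (Q *ᵥ u - (μ : ℂ) • u) ^ 2 ≤ (ρ * (L : ℝ) ^ 4) ^ 2 := by
        calc eucNorm (Q *ᵥ u - (μ : ℂ) • u) ^ 2
            = (star (Q *ᵥ u - (μ : ℂ) • u) ⬝ᵥ (Q *ᵥ u - (μ : ℂ) • u)).re := eucNorm_sq _
          _ ≤ ρ ^ 2 * (L : ℝ) ^ 8 := hru
          _ = (ρ * (L : ℝ) ^ 4) ^ 2 := by ring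
      exact (pow_le_pow_iff_left₀ (eucNorm_nonneg _) hρL two_ne_zero).1 h2
    have h3 := norm_expect_sub_le hu1 Q (μ : ℂ)
    have h4 := Complex.abs_re_le_norm (star u ⬝ᵥ Q *ᵥ u - (μ : ℂ))
    rw [Complex.sub_re, Complex.ofReal_re] at h4
    have h5 := (abs_le.1 (h4.trans (h3.trans h1))).1
    linarith only [h5]
  -- §5 conclusion
  show B - 4 * ρ * (L : ℝ) ^ 4 - c₀ ^ 2 * (θ / τ) * (L : ℝ) ^ 4 ≤ (star u ⬝ᵥ Q *ᵥ u).re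
  have hμρ : 0 ≤ μ + ρ * (L : ℝ) ^ 4 := by
    by_contra hneg
    have : (μ + ρ * (L : ℝ) ^ 4) * nv < 0 := mul_neg_of_neg_of_pos (not_le.1 hneg) hnv_pos
    linarith only [this, hX0, hXle]
  have h6 : (μ + ρ * (L : ℝ) ^ 4) * nv ≤ μ + ρ * (L : ℝ) ^ 4 := mul_le_of_le_one_right hμρ hnv1
  linarith only [hX, hXle, h6, hY, hρL]

end Summit.HubbardSuperconductivity.HubbardSuperconductivity.Theorems

end
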